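import Literature.Barriers.ValiantsHypothesis.ShiftedPartialsDegenerations
import Literature.Barriers.ValiantsHypothesis.ShiftedPartialsMonotone
import Literature.Barriers.ValiantsHypothesis.PartialDerivativesDetPermProofs
import HarnessLib

/-!
# Shifted partial derivatives of `qᵏ` and `y qᵏ` inside a larger polynomial ring
(Gesmundo–Landsberg 2019, §4, Cases 1–2 of the proof of Thm. 2)

Support file for the barrier entry `UnpaddedShiftedPartials.lean` (Gesmundo–Landsberg, Theory of
Computing 15 (2019), Thm. 2: `dim⟨∂^{=e} perm_m⟩_τ ≤ dim⟨∂^{=e} IMM^m_n⟩_τ` for `n > m⁵`). The printed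
proof (§4) compares both sides with the degenerations `F = q_nᵏ` (`m = 2k`) / `ℓ q_nᵏ` (`m = 2k+1`)
of `IMM^m_n`, `q_n = x_1² + ⋯ + x_n²`, whose spaces of partial derivatives are known exactly by
Reznick's theorem (GL Thm. 4, proved in the tree as `span_derivSet_sumSq_pow`:
`⟨∂^{=e} qᵏ⟩ = q^{k-e} · Sᵉ` for `e ≤ k`):

* Case 1 (`e ≥ ⌈m/2⌉`): "`(F_{m,n})_{s,m-s}` surjects onto `S^{m-s}ℂⁿ` ... and thus, for every shift
  `τ`, the shifted partial derivative map surjects onto `S^{m-s+τ}ℂⁿ`", while the permanent "just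
  involves `m²` of the variables" — "the remaining `mn² - n` variables will contribute the same
  growth to the ideals";
* Case 2 (`e < ⌈m/2⌉`): "`(F_{m,n})_{s,m-s}` is injective" and
  `dim⟨∂^{=s} F⟩_τ ≥ binom(n+s+τ-1, s+τ)` "(and equality holds in the case `m` is even)".

This file proves the dimension statements behind both cases for polynomials living in an ARBITRARY
finite set of variables `σ` (the `mn²` variables of `IMM^m_n`), with `q = Σ_{i<z} X_{v i}²` on an
injectively chosen subset `v : Fin z ↪ σ` and, for odd `m`, `F = X_{y₀} · qᵏ` with a variable `y₀`
OUTSIDE the range of `v` (instead of the printed `ℓ qᵏ`; then no analogue of GL's Thm. 7 is needed: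
the derivatives of `y qᵏ` are `y ·` (derivatives of `qᵏ`) and, after one `∂_y`, the derivatives of
`qᵏ`). Everything is counted through the sets of monomials
`T(Z, d, τ) = {μ : |μ| = d + τ, Σ_{u ∈ Z} μ_u ≥ d}` (degree `d + τ`, `Z`-degree at least `d`):

* `shiftedPartialsRank_le_card_filter`: a form `p` of degree `D` in the variables `Z` has
  `rank(p_{(k,D-k)[τ]}) ≤ #T(Z, D-k, τ)` (its shifted partials are supported there) — the
  permanent side ("just involves `m²` of the `mn²` variables");
* `card_filter_le_shiftedPartialsRank`: if `c · x^γ ∈ ⟨∂^{=e} G⟩` for every monomial `x^γ` of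
  degree `d` in the variables `Z` and a fixed `c ≠ 0`, then `#T(Z, d, τ) ≤ rank(G_{(e,·)[τ]})`;
* the hypotheses of the latter for `G = qᵏ` and `G = X_{y₀} qᵏ`: with `c = q^{k-e}` (resp.
  `X_{y₀} q^{k-e}`) and `d = e` when `e ≤ k` (Case 2: `mul_monomial_mem_span_derivSet_sumSq_pow`,
  `X_mul_mul_monomial_mem_span_derivSet`), and with `c = 1`, `d = 2k - e` (resp. `2k + 1 - e`) when
  `e ≥ k` (resp. `e ≥ k + 1`) (Case 1: `monomial_mem_span_derivSet_sumSq_pow`,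
  `monomial_mem_span_derivSet_X_mul_sumSq_pow`), from Reznick's theorem and
  `⟨∂^{=k+j} qᵏ⟩ = S^{k-j}` (`span_derivSet_sumSq_pow_add`).

## References

* [GesmundoLandsberg2017] F. Gesmundo, J. M. Landsberg, Theory Comput. 15 (2019), art. 3
  (arXiv:1705.03866), Thm. 4 and §4 (proof of Thm. 2, Cases 1 and 2).
-/

noncomputable section

namespace Literature.Barriers.ValiantsHypothesis

open MvPolynomial Literature.Computability.AlgebraicComplexity

/-! ### Generic: shifted partials through sets of monomials filtered by `Z`-degree -/

section Generic

variable {K : Type*} [Field K] {σ : Type*}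

/-- Multiplying an element of the span of the order-`e` derivatives by a monomial of degree `τ` lands
in the span of the shifted partials of order `e` and shift `τ`. [folklore] -/
theorem monomial_mul_mem_span_shiftedPartials {e τ : ℕ} {G g : MvPolynomial σ K}
    (hg : g ∈ Submodule.span K (derivSet e G)) {β : σ →₀ ℕ} (hβ : β.degree = τ) :
    monomial β (1 : K) * g ∈ Submodule.span K (shiftedPartials e τ G) := by
  have : Submodule.span K (derivSet e G) ≤
      (Submodule.span K (shiftedPartials e τ G)).comap (LinearMap.mulLeft K (monomial β (1 : K))) := by
    rw [Submodule.span_le]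
    rintro _ ⟨l, hl, rfl⟩
    simp only [SetLike.mem_coe, Submodule.mem_comap, LinearMap.mulLeft_apply]
    exact Submodule.subset_span ⟨l, β, hl, hβ, rfl⟩
  exact this hg

variable [Fintype σ] [DecidableEq σ]

/-- **Lower bound through `Z`-monomials**: if a fixed nonzero multiple `c · x^γ` of every monomial of
degree `d` in the variables `Z` lies in the span of the order-`e` derivatives of `G`, then the number
of monomials of degree `d + τ` and `Z`-degree `≥ d` is at most `rank(G_{(e,·)[τ]})` (multiplication
by `c` is injective and maps the span of these monomials into the span of the shifted partials: below
such a monomial there is a product `x^γ` of `d` variables of `Z`). The mechanism of GL §4, Cases 1–2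
(`c = 1`: "the shifted partial derivative map surjects"; `c = q^{k-s}`: the ideal generated by
`q^{k-s} Sˢ`). [cite: GesmundoLandsberg2017, §4 (Cases 1–2)] -/
theorem card_filter_le_shiftedPartialsRank (Z : Finset σ) (d τ e : ℕ) (G c : MvPolynomial σ K)
    (hc : c ≠ 0)
    (hG : ∀ γ : σ →₀ ℕ, γ.degree = d → γ.support ⊆ Z →
      c * monomial γ (1 : K) ∈ Submodule.span K (derivSet e G)) :
    (((Finset.univ : Finset σ).finsuppAntidiag (d + τ)).filter fun μ => d ≤ ∑ u ∈ Z, μ u).card ≤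
      shiftedPartialsRank K e τ G := by
  classical
  set T := ((Finset.univ : Finset σ).finsuppAntidiag (d + τ)).filter fun μ => d ≤ ∑ u ∈ Z, μ u
    with hT
  haveI := finite_span_shiftedPartials (K := K) e τ G
  have hinj : Function.Injective (LinearMap.mulLeft K c) := fun x y hxy => mul_right_injective₀ hc hxy
  rw [← finrank_restrictSupport (K := K) T,
    (Submodule.equivMapOfInjective _ hinj (restrictSupport K (↑T : Set (σ →₀ ℕ)))).finrank_eq]
  apply Submodule.finrank_mono
  rw [Submodule.map_le_iff_le_comap, restrictSupport_eq_span, Submodule.span_le]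
  rintro _ ⟨μ, hμT, rfl⟩
  rw [Finset.mem_coe, hT, Finset.mem_filter, ← degree_eq_iff_mem_finsuppAntidiag] at hμT
  obtain ⟨hdeg, hsum⟩ := hμT
  obtain ⟨qv, hqZ, hγle⟩ := exists_fun_sum_single_le Z d μ hsum
  set γ : σ →₀ ℕ := ∑ t, Finsupp.single (qv t) 1 with hγ
  have hγdeg : γ.degree = d := by rw [hγ, map_sum]; simp
  have hγsupp : γ.support ⊆ Z := by
    intro u hu
    rw [hγ] at hu
    obtain ⟨t, -, ht⟩ := Finset.mem_biUnion.1 (Finsupp.support_finsetSum hu)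
    rw [Finsupp.support_single _ one_ne_zero, Finset.mem_singleton] at ht
    rw [ht]; exact hqZ t
  have hβ : (μ - γ).degree = τ := by
    have h1 : (μ - γ).degree + γ.degree = μ.degree := by
      rw [← map_add, tsub_add_cancel_of_le hγle]
    omega
  simp only [SetLike.mem_coe, Submodule.mem_comap, LinearMap.mulLeft_apply]
  have hmono : c * monomial μ (1 : K) = monomial (μ - γ) (1 : K) * (c * monomial γ 1) := by
    rw [mul_left_comm, monomial_mul, one_mul, tsub_add_cancel_of_le hγle]
  rw [hmono]
  exact monomial_mul_mem_span_shiftedPartials (hG γ hγdeg hγsupp) hβ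

/-- **Upper bound through `Z`-monomials**: the order-`k` shifted partials of shift `τ` of a form `p` of
degree `D` in the variables `Z` are supported on the monomials of degree `D - k + τ` and `Z`-degree
`≥ D - k`, so their number bounds the rank (GL §4: the permanent "just involves `m²` of the `mn²`
variables"; the shape of ELSW's `I^{P,k} ⊂ S^τ · S^{n-k}ℂ^{m²+1}`). [cite: GesmundoLandsberg2017, §4 (Case 1)] -/
theorem shiftedPartialsRank_le_card_filter {Z : Finset σ} {p : MvPolynomial σ K} {D : ℕ}
    (hp : p.IsHomogeneous D) (hZ : p.vars ⊆ Z) (k τ : ℕ) :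
    shiftedPartialsRank K k τ p ≤
      (((Finset.univ : Finset σ).finsuppAntidiag (D - k + τ)).filter fun μ => D - k ≤ ∑ u ∈ Z, μ u).card := by
  classical
  set T := ((Finset.univ : Finset σ).finsuppAntidiag (D - k + τ)).filter fun μ => D - k ≤ ∑ u ∈ Z, μ u
    with hT
  haveI := finite_restrictSupport (K := K) T
  rw [← finrank_restrictSupport (K := K) T]
  unfold shiftedPartialsRank
  apply Submodule.finrank_mono
  rw [Submodule.span_le]
  rintro _ ⟨l, β, hl, hβ, rfl⟩
  rw [SetLike.mem_coe, mem_restrictSupport_iff]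
  intro μ hμ
  have hw : (iterPDeriv l p).IsHomogeneous (D - k) := hl ▸ isHomogeneous_iterPDeriv hp l
  have hvars : (iterPDeriv l p).vars ⊆ Z := (vars_iterPDeriv_subset l _).trans hZ
  obtain ⟨hdeg, hsum⟩ := support_monomial_mul_subset Z hw hvars β (Finset.mem_coe.1 hμ)
  rw [Finset.mem_coe, hT, Finset.mem_filter, ← degree_eq_iff_mem_finsuppAntidiag]
  refine ⟨?_, hsum⟩
  rw [hdeg, hβ]; omega

/-- With `Z = univ` and `d = 0` the filtered set is all of the degree-`τ` monomials,
`binom(#σ + τ - 1, τ)` of them. [folklore] -/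
theorem card_filter_univ_zero (τ : ℕ) :
    (((Finset.univ : Finset σ).finsuppAntidiag (0 + τ)).filter
        fun μ : σ →₀ ℕ => 0 ≤ ∑ u ∈ (Finset.univ : Finset σ), μ u).card =
      (Fintype.card σ + τ - 1).choose τ := by
  rw [Finset.filter_true_of_mem fun μ _ => Nat.zero_le _, zero_add,
    Finset.card_finsuppAntidiag_nat_eq_choose, Finset.card_univ]

end Generic

/-! ### Derivatives of `qᵏ` of order `≥ k` (all variables, `Fin z`) -/

section SumSqFin

variable {K : Type*} [Field K] [CharZero K] {z : ℕ}

/-- The first partial derivatives of all forms of degree `d + 1` are all forms of degree `d`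
(at least one variable; characteristic `0`: `x^γ = ∂_{i₀}(x_{i₀} x^γ)/(γ_{i₀}+1)`). [folklore] -/
theorem iSup_map_pderiv_restrictSupport_degree_succ (hz : 0 < z) (d : ℕ) :
    ⨆ i : Fin z, (restrictSupport K {γ : Fin z →₀ ℕ | γ.degree = d + 1}).map
        ((pderiv i : Derivation K (MvPolynomial (Fin z) K) (MvPolynomial (Fin z) K)) :
          MvPolynomial (Fin z) K →ₗ[K] MvPolynomial (Fin z) K) =
      restrictSupport K {γ : Fin z →₀ ℕ | γ.degree = d} := by
  classical
  apply le_antisymm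
  · refine iSup_le fun i => Submodule.map_le_iff_le_comap.2 ?_
    rw [restrictSupport_eq_span (R := K) (s := {γ : Fin z →₀ ℕ | γ.degree = d + 1}),
      Submodule.span_le]
    rintro _ ⟨γ, hγ, rfl⟩
    have hγ' : γ.degree = d + 1 := hγ
    simp only [SetLike.mem_coe, Submodule.mem_comap, Derivation.coeFn_coe, pderiv_monomial, one_mul]
    by_cases hi : γ i = 0
    · rw [hi, Nat.cast_zero, monomial_zero]
      exact Submodule.zero_mem _
    · rw [monomial_mem_restrictSupport]
      left
      show (γ - Finsupp.single i 1).degree = d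
      have h1 : γ - Finsupp.single i 1 + Finsupp.single i 1 = γ :=
        tsub_add_cancel_of_le (Finsupp.single_le_iff.2 (Nat.one_le_iff_ne_zero.2 hi))
      have h2 := congrArg Finsupp.degree h1
      rw [map_add, Finsupp.degree_single, hγ'] at h2
      omega
  · rw [restrictSupport_eq_span (R := K) (s := {γ : Fin z →₀ ℕ | γ.degree = d}), Submodule.span_le]
    rintro _ ⟨γ, hγ, rfl⟩
    have hγ' : γ.degree = d := hγ
    set i₀ : Fin z := ⟨0, hz⟩
    have hmem : monomial (γ + Finsupp.single i₀ 1) (1 : K) ∈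
        restrictSupport K {γ : Fin z →₀ ℕ | γ.degree = d + 1} := by
      rw [monomial_mem_restrictSupport]
      left
      show (γ + Finsupp.single i₀ 1).degree = d + 1
      rw [map_add, Finsupp.degree_single, hγ']
    have hne : ((γ i₀ + 1 : ℕ) : K) ≠ 0 := Nat.cast_ne_zero.2 (Nat.succ_ne_zero _)
    have hd : pderiv i₀ (monomial (γ + Finsupp.single i₀ 1) (1 : K)) =
        ((γ i₀ + 1 : ℕ) : K) • monomial γ (1 : K) := by
      rw [pderiv_monomial, add_tsub_cancel_right, Finsupp.add_apply, Finsupp.single_eq_same, one_mul,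
        smul_monomial, smul_eq_mul, mul_one]
    have hγeq : monomial γ (1 : K) =
        ((γ i₀ + 1 : ℕ) : K)⁻¹ • pderiv i₀ (monomial (γ + Finsupp.single i₀ 1) (1 : K)) := by
      rw [hd, smul_smul, inv_mul_cancel₀ hne, one_smul]
    show monomial γ (1 : K) ∈ _
    rw [hγeq]
    exact Submodule.smul_mem _ _ (Submodule.mem_iSup_of_mem i₀ ⟨_, hmem, rfl⟩)

/-- **The derivatives of `qᵏ` of order `k + j` span ALL forms of degree `k - j`** (`j ≤ k`,
`q = x_1² + ⋯ + x_z²`, `z ≥ 1`, characteristic `0`): Reznick's theorem at order `k` gives all of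
`Sᵏ` (GL Thm. 4 with `e = k`), and further derivatives of all forms are all forms. This is the
surjectivity "`(F_{m,n})_{s,m-s}` surjects onto `S^{m-s}ℂⁿ`" for `s ≥ ⌈m/2⌉` used in GL §4, Case 1.
[cite: GesmundoLandsberg2017, Thm. 4 and §4 (Case 1)] -/
theorem span_derivSet_sumSq_pow_add (hz : 0 < z) (k : ℕ) :
    ∀ j : ℕ, j ≤ k →
      Submodule.span K (derivSet (k + j) ((∑ i : Fin z, (X i : MvPolynomial (Fin z) K) ^ 2) ^ k)) =
        restrictSupport K {γ : Fin z →₀ ℕ | γ.degree = k - j}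
  | 0, _ => by
    rw [add_zero, span_derivSet_sumSq_pow k k le_rfl, Nat.sub_self, Nat.sub_zero, pow_zero]
    have : LinearMap.mulLeft K (1 : MvPolynomial (Fin z) K) = LinearMap.id := by
      ext p; simp
    rw [this, Submodule.map_id]
  | j + 1, hj => by
    rw [← add_assoc, span_derivSet_succ, span_derivSet_sumSq_pow_add hz k j (by omega),
      show k - j = (k - (j + 1)) + 1 by omega, iSup_map_pderiv_restrictSupport_degree_succ hz]

end SumSqFin

/-! ### Transport to a subset of the variables -/

section Transport

variable {K : Type*} [Field K] {σ : Type*} {z : ℕ} {v : Fin z → σ}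

/-- `q = Σ_{i<z} X_{v i}²` is the renaming of `x_1² + ⋯ + x_z²`. [folklore] -/
theorem rename_sumSq (v : Fin z → σ) :
    rename v (∑ i : Fin z, (X i : MvPolynomial (Fin z) K) ^ 2) = ∑ i : Fin z, X (v i) ^ 2 := by
  simp [map_sum, map_pow, rename_X]

/-- Injective renamings map order-`e` derivatives to order-`e` derivatives (lists inside the
renamed variables). [folklore] -/
theorem map_rename_span_derivSet_le (hv : Function.Injective v) (f : MvPolynomial (Fin z) K) (e : ℕ) :
    (Submodule.span K (derivSet e f)).map (rename v).toLinearMap ≤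
      Submodule.span K (derivSet e (rename v f)) := by
  rw [Submodule.map_span_le]
  rintro _ ⟨l, hl, rfl⟩
  refine Submodule.subset_span ⟨l.map v, by simp [hl], ?_⟩
  rw [AlgHom.toLinearMap_apply, iterPDeriv_rename hv]

/-- With a variable `y₀` outside the renamed ones: `X_{y₀} ·` (order-`e` derivative of `f`) is an
order-`e` derivative of `X_{y₀} · f` (Leibniz, the derivative list avoiding `y₀`). [folklore] -/
theorem map_X_mul_rename_span_derivSet_le (hv : Function.Injective v) {y₀ : σ} (hy : y₀ ∉ Set.range v)
    (f : MvPolynomial (Fin z) K) (e : ℕ) :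
    (Submodule.span K (derivSet e f)).map
        (LinearMap.mulLeft K (X y₀ : MvPolynomial σ K) ∘ₗ (rename v).toLinearMap) ≤
      Submodule.span K (derivSet e (X y₀ * rename v f)) := by
  rw [Submodule.map_span_le]
  rintro _ ⟨l, hl, rfl⟩
  refine Submodule.subset_span ⟨l.map v, by simp [hl], ?_⟩
  rw [LinearMap.comp_apply, AlgHom.toLinearMap_apply, LinearMap.mulLeft_apply, ← iterPDeriv_rename hv,
    iterPDeriv_mul_left]
  intro u hu huy
  rw [vars_X, Finset.mem_singleton] at huy
  obtain ⟨i, -, rfl⟩ := List.mem_map.1 hu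
  exact hy ⟨i, huy⟩

/-- With a variable `y₀` outside the renamed ones: an order-`e` derivative of `f` is the order-`(e+1)`
derivative of `X_{y₀} · f` along the same list followed by `∂_{y₀}`. [folklore] -/
theorem map_rename_span_derivSet_le_succ (hv : Function.Injective v) {y₀ : σ} (hy : y₀ ∉ Set.range v)
    (f : MvPolynomial (Fin z) K) (e : ℕ) :
    (Submodule.span K (derivSet e f)).map (rename v).toLinearMap ≤
      Submodule.span K (derivSet (e + 1) (X y₀ * rename v f)) := by
  classical
  rw [Submodule.map_span_le]
  rintro _ ⟨l, hl, rfl⟩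
  refine Submodule.subset_span ⟨l.map v ++ [y₀], by simp [hl], ?_⟩
  have hy' : y₀ ∉ (rename v f).vars := by
    intro h
    have := vars_rename v f h
    rw [Finset.mem_image] at this
    obtain ⟨i, -, hi⟩ := this
    exact hy ⟨i, hi⟩
  rw [AlgHom.toLinearMap_apply, iterPDeriv_append, ← iterPDeriv_rename hv]
  congr 1
  rw [iterPDeriv_cons, iterPDeriv_nil, pderiv_mul, pderiv_eq_zero_of_notMem_vars hy', mul_zero,
    add_zero, pderiv_X, Pi.single_eq_same, one_mul]

variable [CharZero K]

/-- **Case 1, even `m = 2k`**: for `k ≤ e ≤ 2k` (and `z ≥ 1`) every monomial of degree `2k - e` in the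
variables `v(Fin z)` lies in `⟨∂^{=e} qᵏ⟩`, `q = Σ_{i<z} X_{v i}²` ("`(F_{m,n})_{s,m-s}` surjects onto
`S^{m-s}ℂⁿ`"). [cite: GesmundoLandsberg2017, §4 (Case 1) and Thm. 4] -/
theorem monomial_mem_span_derivSet_sumSq_pow (hv : Function.Injective v) (hz : 0 < z) {k e : ℕ}
    (hke : k ≤ e) (he : e ≤ 2 * k) (μ : σ →₀ ℕ) (hdeg : μ.degree = 2 * k - e)
    (hsupp : ↑μ.support ⊆ Set.range v) :
    monomial μ (1 : K) ∈ Submodule.span K (derivSet e ((∑ i : Fin z, (X (v i) : MvPolynomial σ K) ^ 2) ^ k)) := by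
  classical
  obtain ⟨γ, rfl⟩ : ∃ γ : Fin z →₀ ℕ, γ.mapDomain v = μ :=
    ⟨μ.comapDomain v hv.injOn, Finsupp.mapDomain_comapDomain v hv μ hsupp⟩
  rw [Finsupp.degree_mapDomain] at hdeg
  have hmem : monomial γ (1 : K) ∈ Submodule.span K
      (derivSet (k + (e - k)) ((∑ i : Fin z, (X i : MvPolynomial (Fin z) K) ^ 2) ^ k)) := by
    rw [span_derivSet_sumSq_pow_add hz k (e - k) (by omega), monomial_mem_restrictSupport]
    left
    show γ.degree = k - (e - k)
    omega
  rw [Nat.add_sub_cancel' hke] at hmem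
  have := map_rename_span_derivSet_le hv _ e ⟨_, hmem, rfl⟩
  rwa [AlgHom.toLinearMap_apply, rename_monomial, map_pow, rename_sumSq] at this

/-- **Case 2, even `m = 2k`**: for `e ≤ k` and every monomial `x^μ` of degree `e` in the variables
`v(Fin z)`, `q^{k-e} x^μ ∈ ⟨∂^{=e} qᵏ⟩` (Reznick: `⟨∂^{=e} qᵏ⟩ = q^{k-e} Sᵉ`; "`(F_{m,n})_{s,m-s}` is
injective"). [cite: GesmundoLandsberg2017, §4 (Case 2) and Thm. 4] -/
theorem mul_monomial_mem_span_derivSet_sumSq_pow (hv : Function.Injective v) {k e : ℕ} (hek : e ≤ k)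
    (μ : σ →₀ ℕ) (hdeg : μ.degree = e) (hsupp : ↑μ.support ⊆ Set.range v) :
    (∑ i : Fin z, (X (v i) : MvPolynomial σ K) ^ 2) ^ (k - e) * monomial μ (1 : K) ∈
      Submodule.span K (derivSet e ((∑ i : Fin z, (X (v i) : MvPolynomial σ K) ^ 2) ^ k)) := by
  classical
  obtain ⟨γ, rfl⟩ : ∃ γ : Fin z →₀ ℕ, γ.mapDomain v = μ :=
    ⟨μ.comapDomain v hv.injOn, Finsupp.mapDomain_comapDomain v hv μ hsupp⟩
  rw [Finsupp.degree_mapDomain] at hdeg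
  have hmem : (∑ i : Fin z, (X i : MvPolynomial (Fin z) K) ^ 2) ^ (k - e) * monomial γ (1 : K) ∈
      Submodule.span K (derivSet e ((∑ i : Fin z, (X i : MvPolynomial (Fin z) K) ^ 2) ^ k)) := by
    rw [span_derivSet_sumSq_pow k e hek]
    exact ⟨monomial γ 1, (monomial_mem_restrictSupport (R := K)).2 (Or.inl hdeg), rfl⟩
  have := map_rename_span_derivSet_le hv _ e ⟨_, hmem, rfl⟩
  rwa [AlgHom.toLinearMap_apply, map_mul, rename_monomial, map_pow, map_pow, rename_sumSq] at this

/-- **Case 1, odd `m = 2k+1`** (with `F = X_{y₀} qᵏ`, `y₀` outside the variables of `q`): for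
`k + 1 ≤ e ≤ 2k + 1` (and `z ≥ 1`) every monomial of degree `2k + 1 - e` in the variables `v(Fin z)`
lies in `⟨∂^{=e} (X_{y₀} qᵏ)⟩` (it is an order-`(e-1)` derivative of `qᵏ = ∂_{y₀}(X_{y₀} qᵏ)`).
[cite: GesmundoLandsberg2017, §4 (Case 1) and Thm. 4] -/
theorem monomial_mem_span_derivSet_X_mul_sumSq_pow (hv : Function.Injective v) {y₀ : σ}
    (hy : y₀ ∉ Set.range v) (hz : 0 < z) {k e : ℕ} (hke : k + 1 ≤ e) (he : e ≤ 2 * k + 1)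
    (μ : σ →₀ ℕ) (hdeg : μ.degree = 2 * k + 1 - e) (hsupp : ↑μ.support ⊆ Set.range v) :
    monomial μ (1 : K) ∈ Submodule.span K
      (derivSet e (X y₀ * (∑ i : Fin z, (X (v i) : MvPolynomial σ K) ^ 2) ^ k)) := by
  classical
  obtain ⟨e', rfl⟩ : ∃ e', e = e' + 1 := ⟨e - 1, by omega⟩
  obtain ⟨γ, rfl⟩ : ∃ γ : Fin z →₀ ℕ, γ.mapDomain v = μ :=
    ⟨μ.comapDomain v hv.injOn, Finsupp.mapDomain_comapDomain v hv μ hsupp⟩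
  rw [Finsupp.degree_mapDomain] at hdeg
  have hmem : monomial γ (1 : K) ∈ Submodule.span K
      (derivSet (k + (e' - k)) ((∑ i : Fin z, (X i : MvPolynomial (Fin z) K) ^ 2) ^ k)) := by
    rw [span_derivSet_sumSq_pow_add hz k (e' - k) (by omega), monomial_mem_restrictSupport]
    left
    show γ.degree = k - (e' - k)
    omega
  rw [Nat.add_sub_cancel' (by omega : k ≤ e')] at hmem
  have := map_rename_span_derivSet_le_succ hv hy _ e' ⟨_, hmem, rfl⟩
  rwa [AlgHom.toLinearMap_apply, rename_monomial, map_pow, rename_sumSq] at this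

/-- **Case 2, odd `m = 2k+1`** (with `F = X_{y₀} qᵏ`): for `e ≤ k` and every monomial `x^μ` of degree
`e` in the variables `v(Fin z)`, `X_{y₀} q^{k-e} x^μ ∈ ⟨∂^{=e} (X_{y₀} qᵏ)⟩`.
[cite: GesmundoLandsberg2017, §4 (Case 2) and Thm. 4] -/
theorem X_mul_mul_monomial_mem_span_derivSet (hv : Function.Injective v) {y₀ : σ}
    (hy : y₀ ∉ Set.range v) {k e : ℕ} (hek : e ≤ k) (μ : σ →₀ ℕ) (hdeg : μ.degree = e)
    (hsupp : ↑μ.support ⊆ Set.range v) :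
    X y₀ * (∑ i : Fin z, (X (v i) : MvPolynomial σ K) ^ 2) ^ (k - e) * monomial μ (1 : K) ∈
      Submodule.span K (derivSet e (X y₀ * (∑ i : Fin z, (X (v i) : MvPolynomial σ K) ^ 2) ^ k)) := by
  classical
  obtain ⟨γ, rfl⟩ : ∃ γ : Fin z →₀ ℕ, γ.mapDomain v = μ :=
    ⟨μ.comapDomain v hv.injOn, Finsupp.mapDomain_comapDomain v hv μ hsupp⟩
  rw [Finsupp.degree_mapDomain] at hdeg
  have hmem : (∑ i : Fin z, (X i : MvPolynomial (Fin z) K) ^ 2) ^ (k - e) * monomial γ (1 : K) ∈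
      Submodule.span K (derivSet e ((∑ i : Fin z, (X i : MvPolynomial (Fin z) K) ^ 2) ^ k)) := by
    rw [span_derivSet_sumSq_pow k e hek]
    exact ⟨monomial γ 1, (monomial_mem_restrictSupport (R := K)).2 (Or.inl hdeg), rfl⟩
  have := map_X_mul_rename_span_derivSet_le hv hy _ e ⟨_, hmem, rfl⟩
  rwa [LinearMap.comp_apply, AlgHom.toLinearMap_apply, LinearMap.mulLeft_apply, map_mul,
    rename_monomial, map_pow, map_pow, rename_sumSq, ← mul_assoc] at this

end Transport


end Literature.Barriers.ValiantsHypothesis
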